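/-
Origin: expansion seat `planner-pub-hodgecm-pv05-g7-0`, handover #11 v2 HANDOVER 2026-08-18T15:39:56Z md5 012abe528f82707d67b8ef4653157681 SUPERSEDES 658c42e1c04de83fdb54e0aa335cef90 (doc-only; v1 never handed) (`HOME/pub-hodgecm-pv05-g7/lean/Pv05g7/FockStoneHamiltonian.lean`, md5 012abe52, 400 lines);
landed by the gen-8 packager in gate run 31 as `HodgeCM/PerL34/FockStoneHamiltonian.lean` (import ^import Pv05g7\.FockStoneClosure[ \t]*$→import HodgeCM.PerL34.FockStoneClosure ×1).
-/
/-
Origin: expansion seat `planner-pub-hodgecm-pv05-g7-0` (unit pub-hodgecm-pv05-g7, DAG-NODE PROVER #05 gen 7), leaf #11.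
Handover import: `Pv05g7.FockStoneClosure` ↦ `HodgeCM.PerL34.FockStoneClosure` (pv05-g7 #9); the second import is the
TREE module `HodgeCM.Vendored.H21.Analysis.UnboundedOperators.UnitaryRep` (vendored Literature layer, no rewrite).

# Stone's theorem for `t ↦ ν₀(e^{tX})` in the package's unbounded-operator vocabulary (`X ∈ 𝔲(σ)`)

KERNEL, additive leaf of the pv05 Fock lane (namespace `HodgeCM.PerL34.Fock.Hermite`).  Mathlib + lane + the vendored
`Literature.Analysis.UnboundedOperators` DEFINITIONS only (`UnitaryRep`, `OneParameterUnitaryGroup`,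
`OneParameterGroup.generator`, `UnitaryRep.hamiltonian`); NONE of that layer's named facts (`isSelfAdjoint_hamiltonian`,
`mem_generator_domain_iff_two_sided`, `dense_generator_domain`, `isClosed_generator`, …) is used as a hypothesis —
on the contrary, their conclusions are PROVED here for the concrete groups of the lane.  Hypotheses are
`[Fintype σ] [DecidableEq σ]` and the displayed `star X = -X`.

1. (§1) `fockGroup hX : OneParameterUnitaryGroup (FockL2 σ)` = `t ↦ ν₀(e^{tX})` (#4 group law, #8 continuity; `appReal` is `rfl`).
2. (§2) a right limit of `t⁻¹(U(t)x − x)` at `0` is a two-sided one (`hasDerivAt_fockRep_expUnitary_of_tendsto_Ioi`).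
3. (§3) **the vendored generator IS the lane's generator**: `OneParameterGroup.generator (fockGroup hX) = genPMap hX`
   as partially defined operators (`genPMap hX := ⟨genDom hX, genOp hX⟩ : FockL2 σ →ₗ.[ℂ] FockL2 σ`), hence
   `(fockGroup hX).hamiltonian = (−i) • genPMap hX`, with domain `genDom hX` (#8: the finite-energy vectors).
4. (§4) for THIS group, the conclusions of the layer's named facts: dense domain, closed generator (#9), domain
   membership iff the TWO-sided quotient converges (and it converges to the generator), `hamiltonian_apply_of_hasDerivAt`.
5. (§5) **Stone's theorem (generator half) for `t ↦ ν₀(e^{tX})`**: `IsSelfAdjoint (fockGroup hX).hamiltonian` (Mathlib's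
   `LinearPMap.adjoint`; from #8 skew-symmetry + #9 `mem_genDom_of_forall_inner_genDom`), hence symmetric and closed.

HONEST LABEL.  Compact directions `X ∈ 𝔲(σ)` only; this is Stone's theorem for THESE concrete groups, via the explicit
spectral resolution of #7/#8 — not the general theorem.  TREE STATUS (checked 2026-08-18T15:27Z, `lean search`): this
package vendors only the layer's DEFINITION files; in the hub tree its named facts are THEOREMS
(`Literature/Analysis/UnboundedOperators/UnitaryRepProofs.lean`: `isSelfAdjoint_hamiltonian_holds`,
`hamiltonian_apply_of_hasDerivAt_holds`, `dense_hamiltonian_domain`; `StrongContRepresentation{,Closed,Density}Proofs.lean`: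
`tendsto_generator_two_sided_holds`, `mem_generator_domain_iff_two_sided_holds`, `isClosed_generator_holds`,
`dense_generator_domain_holds`).  ON MIGRATION §4–§5 below become one-line instances of those at `fockGroup hX` and
should be replaced by them; the lane's own content is §§1–3 (the construction and the EXPLICIT identification
`generator = genPMap`, domain = the finite-energy vectors), which the general theorems do not give.  Inside this package
§4–§5 are proved from the lane and import nothing unproved.  No non-compact directions; no PerL/QW8 claim is touched.
-/
import Summits.HodgeConjecture.HodgeCM.PerL34.FockStoneClosure
import Literature.Analysis.UnboundedOperators.UnitaryRep

/-! PORT of `HodgeCM/PerL34/FockStoneHamiltonian.lean` (HodgeCMPerL run 82) — verbatim mechanical port; provenance in the PORT header line. -/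

noncomputable section

namespace HodgeCM.PerL34.Fock.Hermite

open Complex Matrix Filter Topology
open scoped ComplexConjugate InnerProductSpace NNReal
open Literature.Analysis.UnboundedOperators

/- All inner products below are the Hilbert-space ones of `FockL2 σ` (see the note in `FockLadderAdjoint`). -/
attribute [local instance 10000] InnerProductSpace.toInner

variable {σ : Type*} [Fintype σ] [DecidableEq σ]

omit [DecidableEq σ] in
/-- Real scalars act through `ℂ` on `FockL2 σ`. -/
private theorem rsmul (r : ℝ) (z : FockL2 σ) : r • z = (r : ℂ) • z :=
  (Complex.coe_smul r z).symm

/-! ## §1  `t ↦ ν₀(e^{tX})` as a vendored `OneParameterUnitaryGroup` -/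

/-- `t ↦ e^{tX}` as a monoid homomorphism `Multiplicative ℝ →* U(σ)` (#4 `expUnitary_zero`, `expUnitary_add`). -/
def expUnitaryHom {X : Matrix σ σ ℂ} (hX : star X = -X) : Multiplicative ℝ →* Matrix.unitaryGroup σ ℂ where
  toFun t := expUnitary X hX (Multiplicative.toAdd t)
  map_one' := by rw [toAdd_one, expUnitary_zero]
  map_mul' s t := by rw [toAdd_mul, expUnitary_add]

/-- (Ported verbatim from the HodgeCMPerL package; no docstring in the source.) -/
@[simp]
theorem expUnitaryHom_apply {X : Matrix σ σ ℂ} (hX : star X = -X) (t : Multiplicative ℝ) :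
    expUnitaryHom hX t = expUnitary X hX (Multiplicative.toAdd t) := rfl

/-- `t ↦ ν₀(e^{tX})` as a monoid homomorphism into the bounded operators of `𝓕_σ`
(through Mathlib's `Unitary.linearIsometryEquiv : unitary (H →L[ℂ] H) ≃* (H ≃ₗᵢ[ℂ] H)`). -/
def fockGroupHom {X : Matrix σ σ ℂ} (hX : star X = -X) : Multiplicative ℝ →* (FockL2 σ →L[ℂ] FockL2 σ) :=
  ((unitary (FockL2 σ →L[ℂ] FockL2 σ)).subtype.comp
      (Unitary.linearIsometryEquiv (𝕜 := ℂ) (H := FockL2 σ)).symm.toMonoidHom).comp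
    (fockRep.comp (expUnitaryHom hX))

/-- (Ported verbatim from the HodgeCMPerL package; no docstring in the source.) -/
theorem fockGroupHom_apply {X : Matrix σ σ ℂ} (hX : star X = -X) (t : Multiplicative ℝ) :
    fockGroupHom hX t
      = ((fockRep (expUnitary X hX (Multiplicative.toAdd t)) : FockL2 σ ≃ₗᵢ[ℂ] FockL2 σ) :
          FockL2 σ →L[ℂ] FockL2 σ) := rfl

/-- (Ported verbatim from the HodgeCMPerL package; no docstring in the source.) -/
@[simp]
theorem fockGroupHom_apply_apply {X : Matrix σ σ ℂ} (hX : star X = -X) (t : Multiplicative ℝ) (v : FockL2 σ) :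
    fockGroupHom hX t v = fockRep (expUnitary X hX (Multiplicative.toAdd t)) v := rfl

/-- (Ported verbatim from the HodgeCMPerL package; no docstring in the source.) -/
theorem fockGroupHom_mem_unitary {X : Matrix σ σ ℂ} (hX : star X = -X) (t : Multiplicative ℝ) :
    fockGroupHom hX t ∈ unitary (FockL2 σ →L[ℂ] FockL2 σ) :=
  (Unitary.linearIsometryEquiv.symm (fockRep (expUnitary X hX (Multiplicative.toAdd t)))).2

/-- **The strongly continuous one-parameter unitary group `t ↦ ν₀(e^{tX})` on `𝓕_σ`**, `X ∈ 𝔲(σ)`, as a term of the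
vendored `Literature.Analysis.UnboundedOperators.OneParameterUnitaryGroup (FockL2 σ)`
(= `UnitaryRep (Multiplicative ℝ) (FockL2 σ)`); strong continuity is #8 `continuous_fockRep_expUnitary_apply`. -/
def fockGroup {X : Matrix σ σ ℂ} (hX : star X = -X) : OneParameterUnitaryGroup (FockL2 σ) where
  toMonoidHom := fockGroupHom hX
  strongly_continuous v :=
    ((continuous_fockRep_expUnitary_apply hX v).comp continuous_toAdd).congr fun _ => rfl
  mem_unitary t := fockGroupHom_mem_unitary hX t

/-- (Ported verbatim from the HodgeCMPerL package; no docstring in the source.) -/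
@[simp]
theorem fockGroup_apply {X : Matrix σ σ ℂ} (hX : star X = -X) (g : Multiplicative ℝ) :
    fockGroup hX g = fockGroupHom hX g := rfl

/-- `U(t) v = ν₀(e^{tX}) v` for the vendored time-`t` operator `UnitaryRep.appReal`. -/
@[simp]
theorem fockGroup_appReal_apply {X : Matrix σ σ ℂ} (hX : star X = -X) (t : ℝ) (v : FockL2 σ) :
    (fockGroup hX).appReal t v = fockRep (expUnitary X hX t) v := rfl

/-- `U(t) v = ν₀(e^{tX}) v` for the vendored `OneParameterGroup.app` of the underlying one-parameter group. -/
@[simp]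
theorem fockGroup_app_apply {X : Matrix σ σ ℂ} (hX : star X = -X) (t : ℝ) (v : FockL2 σ) :
    OneParameterGroup.app (fockGroup hX).toStrongContRepresentation t v = fockRep (expUnitary X hX t) v := rfl

/-- The forward semigroup's `T(t⁺) v = ν₀(e^{(max t 0) X}) v`. -/
theorem fockGroup_toC0Semigroup_app_apply {X : Matrix σ σ ℂ} (hX : star X = -X) (t : ℝ) (v : FockL2 σ) :
    (OneParameterGroup.toC0Semigroup (fockGroup hX).toStrongContRepresentation).app t.toNNReal v
      = fockRep (expUnitary X hX (max t 0)) v := rfl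

/-! ## §2  One-sided versus two-sided difference quotients -/

/-- Joint continuity at `t = 0`: if `a(t) → b` along a filter finer than `𝓝 0` then `ν₀(e^{tX}) a(t) → b` along it
(strong continuity of #8 + isometry). -/
theorem tendsto_fockRep_expUnitary_apply_of_tendsto_filter {X : Matrix σ σ ℂ} (hX : star X = -X) {l : Filter ℝ}
    (hl : l ≤ 𝓝 0) {a : ℝ → FockL2 σ} {b : FockL2 σ} (ha : Tendsto a l (𝓝 b)) :
    Tendsto (fun t : ℝ => fockRep (expUnitary X hX t) (a t)) l (𝓝 b) := by
  rw [tendsto_iff_norm_sub_tendsto_zero] at ha ⊢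
  have h2 : Tendsto (fun t : ℝ => ‖fockRep (expUnitary X hX t) b - b‖) l (𝓝 0) := by
    have h := (tendsto_fockRep_expUnitary_zero hX b).mono_left hl
    rw [tendsto_iff_norm_sub_tendsto_zero] at h
    exact h
  have hsum := ha.add h2
  rw [add_zero] at hsum
  refine squeeze_zero (fun t => norm_nonneg _) (fun t => ?_) hsum
  calc ‖fockRep (expUnitary X hX t) (a t) - b‖
      ≤ ‖fockRep (expUnitary X hX t) (a t) - fockRep (expUnitary X hX t) b‖ + ‖fockRep (expUnitary X hX t) b - b‖ :=
        norm_sub_le_norm_sub_add_norm_sub _ _ _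
    _ = ‖a t - b‖ + ‖fockRep (expUnitary X hX t) b - b‖ := by rw [← map_sub, LinearIsometryEquiv.norm_map]

/-- `ν₀(e^{tX}) (ν₀(e^{−tX}) x) = x`. -/
theorem fockRep_expUnitary_apply_neg {X : Matrix σ σ ℂ} (hX : star X = -X) (t : ℝ) (x : FockL2 σ) :
    fockRep (expUnitary X hX t) (fockRep (expUnitary X hX (-t)) x) = x := by
  have h := congrArg (fun U => fockRep U x) (expUnitary_add hX t (-t))
  simp only [add_neg_cancel, expUnitary_zero, map_one, map_mul, LinearIsometryEquiv.coe_one, id_eq,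
    LinearIsometryEquiv.coe_mul, Function.comp_apply] at h
  exact h.symm

/-- Reflection of the difference quotient: `t⁻¹(U(t)x − x) = U(t) ((−t)⁻¹(U(−t)x − x))`. -/
theorem quot_fockRep_expUnitary_reflect {X : Matrix σ σ ℂ} (hX : star X = -X) (x : FockL2 σ) (t : ℝ) :
    ((t⁻¹ : ℝ) : ℂ) • (fockRep (expUnitary X hX t) x - x)
      = fockRep (expUnitary X hX t) ((((-t)⁻¹ : ℝ) : ℂ) • (fockRep (expUnitary X hX (-t)) x - x)) := by
  rw [map_smul, map_sub, fockRep_expUnitary_apply_neg, inv_neg, Complex.ofReal_neg, neg_smul, ← smul_neg,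
    neg_sub]

/-- The difference quotient in Mathlib's `hasDerivAt_iff_tendsto_slope_zero` form equals the `ℂ`-scalar form. -/
private theorem slope_eq {X : Matrix σ σ ℂ} (hX : star X = -X) (x : FockL2 σ) (t : ℝ) :
    t⁻¹ • (fockRep (expUnitary X hX (0 + t)) x - fockRep (expUnitary X hX 0) x)
      = ((t⁻¹ : ℝ) : ℂ) • (fockRep (expUnitary X hX t) x - x) := by
  rw [zero_add, expUnitary_zero, map_one, LinearIsometryEquiv.coe_one, id_eq, rsmul]

/-- `d/dt|₀ ν₀(e^{tX}) x = y` iff the two-sided quotient `t⁻¹(ν₀(e^{tX})x − x) → y` (`t → 0`, `t ≠ 0`). -/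
theorem hasDerivAt_fockRep_expUnitary_iff_tendsto {X : Matrix σ σ ℂ} (hX : star X = -X) (x y : FockL2 σ) :
    HasDerivAt (fun t : ℝ => fockRep (expUnitary X hX t) x) y 0 ↔
      Tendsto (fun t : ℝ => ((t⁻¹ : ℝ) : ℂ) • (fockRep (expUnitary X hX t) x - x)) (𝓝[≠] 0) (𝓝 y) := by
  rw [hasDerivAt_iff_tendsto_slope_zero]
  exact ⟨fun h => h.congr fun t => slope_eq hX x t, fun h => h.congr fun t => (slope_eq hX x t).symm⟩

/-- **Right-differentiability at `0` is two-sided differentiability** for the unitary group `t ↦ ν₀(e^{tX})`: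
if `t⁻¹(ν₀(e^{tX})x − x) → y` as `t ↓ 0` then `d/dt|₀ ν₀(e^{tX}) x = y`. -/
theorem hasDerivAt_fockRep_expUnitary_of_tendsto_Ioi {X : Matrix σ σ ℂ} (hX : star X = -X) {x y : FockL2 σ}
    (h : Tendsto (fun t : ℝ => ((t⁻¹ : ℝ) : ℂ) • (fockRep (expUnitary X hX t) x - x)) (𝓝[>] 0) (𝓝 y)) :
    HasDerivAt (fun t : ℝ => fockRep (expUnitary X hX t) x) y 0 := by
  rw [hasDerivAt_fockRep_expUnitary_iff_tendsto, ← nhdsLT_sup_nhdsGT]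
  refine Tendsto.sup ?_ h
  have hneg : Tendsto (fun t : ℝ => -t) (𝓝[<] (0 : ℝ)) (𝓝[>] 0) := by
    refine tendsto_nhdsWithin_of_tendsto_nhds_of_eventually_within _ ?_ ?_
    · exact (continuous_neg.tendsto' (0 : ℝ) 0 neg_zero).mono_left nhdsWithin_le_nhds
    · filter_upwards [self_mem_nhdsWithin] with t ht
      exact Set.mem_Ioi.mpr (neg_pos.mpr ht)
  have h1 : Tendsto (fun t : ℝ => (((-t)⁻¹ : ℝ) : ℂ) • (fockRep (expUnitary X hX (-t)) x - x)) (𝓝[<] 0) (𝓝 y) :=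
    h.comp hneg
  exact (tendsto_fockRep_expUnitary_apply_of_tendsto_filter hX nhdsWithin_le_nhds h1).congr fun t =>
    (quot_fockRep_expUnitary_reflect hX x t).symm

/-- The vendored forward-semigroup quotient agrees with the plain quotient for `t > 0`. -/
theorem toC0Semigroup_quot_eventuallyEq {X : Matrix σ σ ℂ} (hX : star X = -X) (x : FockL2 σ) :
    (fun t : ℝ => ((t⁻¹ : ℝ) : ℂ) •
        ((OneParameterGroup.toC0Semigroup (fockGroup hX).toStrongContRepresentation).app t.toNNReal x - x))
      =ᶠ[𝓝[>] 0] fun t => ((t⁻¹ : ℝ) : ℂ) • (fockRep (expUnitary X hX t) x - x) := by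
  filter_upwards [self_mem_nhdsWithin] with t ht
  rw [fockGroup_toC0Semigroup_app_apply, max_eq_left (le_of_lt (Set.mem_Ioi.mp ht))]

/-! ## §3  The vendored generator is `⟨genDom, genOp⟩`; the Hamiltonian is `−i · genOp` -/

/-- The lane's Stone generator as a partially defined operator `𝓕_σ →ₗ.[ℂ] 𝓕_σ` (Mathlib `LinearPMap`). -/
abbrev genPMap {X : Matrix σ σ ℂ} (hX : star X = -X) : FockL2 σ →ₗ.[ℂ] FockL2 σ :=
  ⟨genDom hX, genOp hX⟩

/-- (Ported verbatim from the HodgeCMPerL package; no docstring in the source.) -/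
@[simp]
theorem genPMap_domain {X : Matrix σ σ ℂ} (hX : star X = -X) : (genPMap hX).domain = genDom hX := rfl

/-- (Ported verbatim from the HodgeCMPerL package; no docstring in the source.) -/
@[simp]
theorem genPMap_apply {X : Matrix σ σ ℂ} (hX : star X = -X) (v : genDom hX) : genPMap hX v = genOp hX v := rfl

/-- For `v ∈ genDom`, the vendored (one-sided) quotient converges to `genOp v`. -/
theorem tendsto_toC0Semigroup_quot_genOp {X : Matrix σ σ ℂ} (hX : star X = -X) (v : genDom hX) :
    Tendsto (fun t : ℝ => ((t⁻¹ : ℝ) : ℂ) •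
        ((OneParameterGroup.toC0Semigroup (fockGroup hX).toStrongContRepresentation).app t.toNNReal (v : FockL2 σ)
          - v)) (𝓝[>] 0) (𝓝 (genOp hX v)) := by
  have h := (hasDerivAt_fockRep_expUnitary_iff_tendsto hX _ _).mp (hasDerivAt_fockRep_expUnitary_genOp hX v)
  exact (h.mono_left (nhdsWithin_mono _ fun t ht => Set.mem_compl_singleton_iff.mpr (ne_of_gt ht))).congr'
    (toC0Semigroup_quot_eventuallyEq hX (v : FockL2 σ)).symm

/-- (Ported verbatim from the HodgeCMPerL package; no docstring in the source.) -/
theorem mem_generator_domain_of_mem_genDom {X : Matrix σ σ ℂ} (hX : star X = -X) {x : FockL2 σ}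
    (hx : x ∈ genDom hX) :
    x ∈ (OneParameterGroup.generator (fockGroup hX).toStrongContRepresentation).domain :=
  (C0Semigroup.mem_generator_domain_iff _ x).mpr ⟨genOp hX ⟨x, hx⟩, tendsto_toC0Semigroup_quot_genOp hX ⟨x, hx⟩⟩

/-- (Ported verbatim from the HodgeCMPerL package; no docstring in the source.) -/
theorem mem_genDom_of_mem_generator_domain {X : Matrix σ σ ℂ} (hX : star X = -X) {x : FockL2 σ}
    (hx : x ∈ (OneParameterGroup.generator (fockGroup hX).toStrongContRepresentation).domain) :
    x ∈ genDom hX := by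
  obtain ⟨y, hy⟩ := (C0Semigroup.mem_generator_domain_iff _ x).mp hx
  exact (mem_genDom_of_hasDerivAt hX
    (hasDerivAt_fockRep_expUnitary_of_tendsto_Ioi hX (hy.congr' (toC0Semigroup_quot_eventuallyEq hX x)))).1

/-- **The domain of the vendored generator is `genDom`** (the finite-energy = differentiable vectors of #8). -/
theorem generator_fockGroup_domain {X : Matrix σ σ ℂ} (hX : star X = -X) :
    (OneParameterGroup.generator (fockGroup hX).toStrongContRepresentation).domain = genDom hX :=
  le_antisymm (fun _ hx => mem_genDom_of_mem_generator_domain hX hx)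
    (fun _ hx => mem_generator_domain_of_mem_genDom hX hx)

/-- … and on it the vendored generator is `genOp`. -/
theorem generator_fockGroup_apply {X : Matrix σ σ ℂ} (hX : star X = -X)
    (x : (OneParameterGroup.generator (fockGroup hX).toStrongContRepresentation).domain) :
    OneParameterGroup.generator (fockGroup hX).toStrongContRepresentation x
      = genOp hX ⟨x, mem_genDom_of_mem_generator_domain hX x.2⟩ :=
  C0Semigroup.generator_apply_eq_of_tendsto _ x
    (tendsto_toC0Semigroup_quot_genOp hX ⟨x, mem_genDom_of_mem_generator_domain hX x.2⟩)

/-- **The vendored generator of `t ↦ ν₀(e^{tX})` is the lane's `⟨genDom, genOp⟩`** as a `LinearPMap`. -/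
theorem generator_fockGroup {X : Matrix σ σ ℂ} (hX : star X = -X) :
    OneParameterGroup.generator (fockGroup hX).toStrongContRepresentation = genPMap hX := by
  refine LinearPMap.ext (generator_fockGroup_domain hX) fun x hf hg => ?_
  rw [generator_fockGroup_apply]
  rfl

/-- **The Hamiltonian** (vendored `UnitaryRep.hamiltonian`, physics convention `U(t) = e^{itH}`) of `t ↦ ν₀(e^{tX})`
is `−i · genOp` on `genDom`. -/
theorem hamiltonian_fockGroup {X : Matrix σ σ ℂ} (hX : star X = -X) :
    (fockGroup hX).hamiltonian = (-I) • genPMap hX := by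
  rw [UnitaryRep.hamiltonian, generator_fockGroup]

/-- (Ported verbatim from the HodgeCMPerL package; no docstring in the source.) -/
theorem hamiltonian_fockGroup_domain {X : Matrix σ σ ℂ} (hX : star X = -X) :
    (fockGroup hX).hamiltonian.domain = genDom hX := by
  rw [hamiltonian_fockGroup]
  rfl

/-- (Ported verbatim from the HodgeCMPerL package; no docstring in the source.) -/
theorem mem_hamiltonian_fockGroup_domain_iff {X : Matrix σ σ ℂ} (hX : star X = -X) (x : FockL2 σ) :
    x ∈ (fockGroup hX).hamiltonian.domain ↔ x ∈ genDom hX := by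
  rw [hamiltonian_fockGroup_domain]

/-- (Ported verbatim from the HodgeCMPerL package; no docstring in the source.) -/
theorem hamiltonian_fockGroup_apply {X : Matrix σ σ ℂ} (hX : star X = -X) {x : FockL2 σ}
    (hx : x ∈ (fockGroup hX).hamiltonian.domain) :
    (fockGroup hX).hamiltonian ⟨x, hx⟩
      = (-I) • genOp hX ⟨x, (mem_hamiltonian_fockGroup_domain_iff hX x).mp hx⟩ := by
  have h := (LinearPMap.ext_iff.mp (hamiltonian_fockGroup hX)).2 (x := x) (hf := hx)
    (hg := (mem_hamiltonian_fockGroup_domain_iff hX x).mp hx)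
  rw [h, LinearPMap.smul_apply]
  rfl

/-! ## §4  The named facts of the vendored layer, PROVED for this group -/

/-- `genDom` is dense (it contains the polynomial core, #6 `denseRange_fockToL2`). -/
theorem dense_genDom {X : Matrix σ σ ℂ} (hX : star X = -X) : Dense (genDom hX : Set (FockL2 σ)) :=
  Dense.mono (Set.range_subset_iff.mpr fun F => fockToL2_mem_genDom hX F)
    (denseRange_fockToL2 (σ := σ) : Dense (Set.range (fockToL2 (σ := σ))))

/-- Conclusion of the named fact `C0Semigroup.dense_generator_domain`, for this group. -/
theorem dense_generator_fockGroup_domain {X : Matrix σ σ ℂ} (hX : star X = -X) :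
    Dense ((OneParameterGroup.generator (fockGroup hX).toStrongContRepresentation).domain : Set (FockL2 σ)) := by
  rw [generator_fockGroup_domain]
  exact dense_genDom hX

/-- (Ported verbatim from the HodgeCMPerL package; no docstring in the source.) -/
theorem dense_hamiltonian_fockGroup_domain {X : Matrix σ σ ℂ} (hX : star X = -X) :
    Dense ((fockGroup hX).hamiltonian.domain : Set (FockL2 σ)) := by
  rw [hamiltonian_fockGroup_domain]
  exact dense_genDom hX

/-- `⟨genDom, genOp⟩` is a CLOSED operator in Mathlib's sense (#9 `mem_genDom_of_tendsto`, `genOp_eq_of_tendsto`). -/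
theorem isClosed_genPMap {X : Matrix σ σ ℂ} (hX : star X = -X) : (genPMap hX).IsClosed := by
  show _root_.IsClosed ((genPMap hX).graph : Set (FockL2 σ × FockL2 σ))
  refine IsSeqClosed.isClosed fun p q hp hq => ?_
  have hv : ∀ n, ∃ v : genDom hX, ((v : FockL2 σ), genOp hX v) = p n := fun n =>
    (LinearPMap.mem_graph_iff' _).mp (hp n)
  choose v hv using hv
  have h1 : Tendsto (fun n => (v n : FockL2 σ)) atTop (𝓝 q.1) :=
    ((continuous_fst.tendsto q).comp hq).congr fun n => by rw [Function.comp_apply, ← hv n]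
  have h2 : Tendsto (fun n => genOp hX (v n)) atTop (𝓝 q.2) :=
    ((continuous_snd.tendsto q).comp hq).congr fun n => by rw [Function.comp_apply, ← hv n]
  have hq1 : q.1 ∈ genDom hX := mem_genDom_of_tendsto hX h1 h2
  have hq2 : genOp hX ⟨q.1, hq1⟩ = q.2 := genOp_eq_of_tendsto hX h1 h2
  rw [SetLike.mem_coe, LinearPMap.mem_graph_iff']
  exact ⟨⟨q.1, hq1⟩, Prod.ext rfl hq2⟩

/-- Conclusion of the named fact `C0Semigroup.isClosed_generator`, for this group. -/
theorem isClosed_generator_fockGroup {X : Matrix σ σ ℂ} (hX : star X = -X) :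
    (OneParameterGroup.generator (fockGroup hX).toStrongContRepresentation).IsClosed := by
  rw [generator_fockGroup]
  exact isClosed_genPMap hX

/-- Conclusion of the named fact `OneParameterGroup.mem_generator_domain_iff_two_sided`, for this group:
`x ∈ D(A)` iff the TWO-sided quotient `t⁻¹(U(t)x − x)` converges. -/
theorem mem_generator_fockGroup_domain_iff_two_sided {X : Matrix σ σ ℂ} (hX : star X = -X) (x : FockL2 σ) :
    x ∈ (OneParameterGroup.generator (fockGroup hX).toStrongContRepresentation).domain ↔
      ∃ y : FockL2 σ, Tendsto (fun t : ℝ => ((t⁻¹ : ℝ) : ℂ) •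
        (OneParameterGroup.app (fockGroup hX).toStrongContRepresentation t x - x)) (𝓝[≠] 0) (𝓝 y) := by
  rw [generator_fockGroup_domain]
  simp only [fockGroup_app_apply]
  constructor
  · intro hx
    exact ⟨genOp hX ⟨x, hx⟩,
      (hasDerivAt_fockRep_expUnitary_iff_tendsto hX _ _).mp (hasDerivAt_fockRep_expUnitary_genOp hX ⟨x, hx⟩)⟩
  · rintro ⟨y, hy⟩
    exact (mem_genDom_of_hasDerivAt hX ((hasDerivAt_fockRep_expUnitary_iff_tendsto hX x y).mpr hy)).1

/-- Conclusion of the named fact `OneParameterGroup.tendsto_generator_two_sided`, for this group. -/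
theorem tendsto_generator_fockGroup_two_sided {X : Matrix σ σ ℂ} (hX : star X = -X)
    (x : (OneParameterGroup.generator (fockGroup hX).toStrongContRepresentation).domain) :
    Tendsto (fun t : ℝ => ((t⁻¹ : ℝ) : ℂ) •
        (OneParameterGroup.app (fockGroup hX).toStrongContRepresentation t (x : FockL2 σ) - x)) (𝓝[≠] 0)
      (𝓝 (OneParameterGroup.generator (fockGroup hX).toStrongContRepresentation x)) := by
  rw [generator_fockGroup_apply]
  simp only [fockGroup_app_apply]
  exact (hasDerivAt_fockRep_expUnitary_iff_tendsto hX _ _).mp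
    (hasDerivAt_fockRep_expUnitary_genOp hX ⟨x, mem_genDom_of_mem_generator_domain hX x.2⟩)

/-- Conclusion of the named fact `UnitaryRep.hamiltonian_apply_of_hasDerivAt`, for this group: if `t ↦ U(t)ψ` is
differentiable at `0` with derivative `η` then `ψ ∈ D(H)` and `Hψ = −iη` (#8 `mem_genDom_of_hasDerivAt`). -/
theorem hamiltonian_fockGroup_apply_of_hasDerivAt {X : Matrix σ σ ℂ} (hX : star X = -X) {ψ η : FockL2 σ}
    (h : HasDerivAt (fun t : ℝ => (fockGroup hX).appReal t ψ) η 0) :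
    ∃ hψ : ψ ∈ (fockGroup hX).hamiltonian.domain, (fockGroup hX).hamiltonian ⟨ψ, hψ⟩ = (-I) • η := by
  have h' : HasDerivAt (fun t : ℝ => fockRep (expUnitary X hX t) ψ) η 0 := h
  refine ⟨(mem_hamiltonian_fockGroup_domain_iff hX ψ).mpr (mem_genDom_of_hasDerivAt hX h').1, ?_⟩
  rw [hamiltonian_fockGroup_apply, genOp_eq_of_hasDerivAt hX h']

/-! ## §5  Stone's theorem for `t ↦ ν₀(e^{tX})`: the Hamiltonian is self-adjoint -/

/-- `−i · genOp` is symmetric on `genDom` (#8 `inner_genOp_add_inner_genOp`). -/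
theorem isFormalAdjoint_smul_genPMap {X : Matrix σ σ ℂ} (hX : star X = -X) :
    ((-I) • genPMap hX).IsFormalAdjoint ((-I) • genPMap hX) := by
  intro x y
  have hskew : ⟪genPMap hX x, (y : FockL2 σ)⟫_ℂ + ⟪(x : FockL2 σ), genPMap hX y⟫_ℂ = 0 :=
    inner_genOp_add_inner_genOp hX ⟨x, x.2⟩ ⟨y, y.2⟩
  rw [LinearPMap.smul_apply, LinearPMap.smul_apply, inner_smul_left (E := FockL2 σ),
    inner_smul_right (E := FockL2 σ), map_neg, Complex.conj_I, neg_neg, eq_neg_of_add_eq_zero_left hskew]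
  ring


-- port_pkg: scope closed for this part
end HodgeCM.PerL34.Fock.Hermite
end
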